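import Summits.MatrixMultiplication.OmegaCensus.CubeLawParityParseval
import HarnessLib

/-!
# Law-attaining cube triples over `A` with `dim A/2A ≥ 3`: every coset part has size `≡ ±1 (mod 8)`

ω-census, family (b3).  Framing: lottery ticket; floor = certified bounds/negative ranges.

Refinement of `no_law_cube_part_small` (`CubeLawParityParseval.lean`).  With `x = |T₀|`, three homomorphisms
`ψ : A → 𝔽₂³` jointly onto, `n_v = |T₀ ∩ ψ⁻¹(v)|` and `N = #{(t,t') ∈ T₀² : ψ t = ψ t'} = ∑_v n_v²`, the parity
theorem gives the Parseval identity `x² + 7 = 8N`; since `N + x = ∑_v n_v(n_v + 1)` is even, `x² + 7 ≡ 8x (mod 16)`,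
i.e. `(x − 1)(x − 7) ≡ 0 (mod 16)`, i.e. **`x ≡ 1` or `7 (mod 8)`** (`cube_part_mod_eight`; `_left`, `_right` for the
parts of `S`, `U`).  Census use: `|A| = 232 = 3·77 + 1`, shape `(1,7,11)` over `ℤ₂³ × ℤ₂₉` — the part `11 ≡ 3 (mod 8)`
is impossible, so the classification 'law ⟹ element of order ≥ |A|/2' also holds at `|A| = 232`; generally parts
`3, 5, 11, 13, 19, 21, …` never occur over `A` of `2`-rank `≥ 3`.
-/

namespace Summit.MatrixMultiplication.OmegaCensus

open Literature.Combinatorics.Additive Finset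

section DihedralLike

variable {A : Type*} [AddCommGroup A] [DecidableEq A] [Fintype A] {G : Type} [Group G] [DecidableEq G]
  {ρ τ : A → G} {c₀ : A} {S T U : Finset G}

/-- **Cube law shape over `A` with `dim A/2A ≥ 3` ⇒ `|T₀| ≡ ±1 (mod 8)`.**  Dihedral-like `G` over `A`; three
homomorphisms `A →+ ZMod 2` jointly onto `𝔽₂³`; a TPP triple with cube part sizes attaining `3|S||T||U| + 8 = 8|A|`
has `|T₀| % 8 ∈ {1, 7}` (Parseval `x² + 7 = 8N` and `N ≡ x (mod 2)`). [folklore] -/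
theorem cube_part_mod_eight
    (hρρ : ∀ a b, ρ a * ρ b = ρ (a + b)) (hρτ : ∀ a b, ρ a * τ b = τ (b - a))
    (hτρ : ∀ a b, τ a * ρ b = τ (a + b)) (hττ : ∀ a b, τ a * τ b = ρ (c₀ + b - a))
    (hρ : Function.Injective ρ) (hτ : Function.Injective τ) (hne : ∀ a b, ρ a ≠ τ b)
    (hsurj : ∀ g, (∃ a, ρ a = g) ∨ (∃ a, τ a = g))
    (ψ₁ ψ₂ ψ₃ : A →+ ZMod 2) (hψ : ∀ v : ZMod 2 × ZMod 2 × ZMod 2, ∃ a, (ψ₁ a, ψ₂ a, ψ₃ a) = v)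
    (h : TripleProductProperty S T U)
    (hS : (univ.filter fun a : A => ρ a ∈ S).card = (univ.filter fun a : A => τ a ∈ S).card)
    (hT : (univ.filter fun a : A => ρ a ∈ T).card = (univ.filter fun a : A => τ a ∈ T).card)
    (hU : (univ.filter fun a : A => ρ a ∈ U).card = (univ.filter fun a : A => τ a ∈ U).card)
    (hV : 3 * (S.card * T.card * U.card) + 8 = 8 * Fintype.card A) :
    (univ.filter fun a : A => ρ a ∈ T).card % 8 = 1 ∨ (univ.filter fun a : A => ρ a ∈ T).card % 8 = 7 := by
  set T₀ := univ.filter fun a : A => ρ a ∈ T with hT₀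
  -- the map to `𝔽₂³` and the characters `χ_w`
  let Ψ : A → ZMod 2 × ZMod 2 × ZMod 2 := fun a => (ψ₁ a, ψ₂ a, ψ₃ a)
  have hΨadd : ∀ a b, Ψ (a + b) = Ψ a + Ψ b := fun a b => by
    simp only [Ψ, map_add, Prod.mk_add_mk]
  let s : ZMod 2 × ZMod 2 × ZMod 2 → ZMod 2 × ZMod 2 × ZMod 2 → ℤ :=
    fun w u => if w.1 * u.1 + w.2.1 * u.2.1 + w.2.2 * u.2.2 = 0 then 1 else -1
  -- each non-zero `w` gives `χ_w(T₀)² = 1`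
  have hsq : ∀ w : ZMod 2 × ZMod 2 × ZMod 2, w ≠ 0 → (∑ t ∈ T₀, s w (Ψ t)) ^ 2 = 1 := by
    intro w hw
    let φ : A →+ ZMod 2 :=
      { toFun := fun a => w.1 * ψ₁ a + w.2.1 * ψ₂ a + w.2.2 * ψ₃ a
        map_zero' := by simp
        map_add' := fun a b => by simp only [map_add]; ring }
    obtain ⟨z, hz⟩ := f2cube_exists_pair_one w hw
    obtain ⟨a, ha⟩ := hψ z
    have hφ : ∃ a, φ a ≠ 0 := by
      refine ⟨a, ?_⟩
      show w.1 * ψ₁ a + w.2.1 * ψ₂ a + w.2.2 * ψ₃ a ≠ 0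
      have h1 : ψ₁ a = z.1 := congrArg Prod.fst ha
      have h2 : ψ₂ a = z.2.1 := congrArg (fun p => p.2.1) ha
      have h3 : ψ₃ a = z.2.2 := congrArg (fun p => p.2.2) ha
      rw [h1, h2, h3, hz]
      exact one_ne_zero
    have hval : ∀ a, (fun a => if φ a = 0 then (1 : ℤ) else -1) a = 1 ∨
        (fun a => if φ a = 0 then (1 : ℤ) else -1) a = -1 := fun a => by
      simp only; split_ifs
      · exact Or.inl rfl
      · exact Or.inr rfl
    have hmul : ∀ a b, (fun a => if φ a = 0 then (1 : ℤ) else -1) (a + b) =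
        (fun a => if φ a = 0 then (1 : ℤ) else -1) a * (fun a => if φ a = 0 then (1 : ℤ) else -1) b := by
      intro a b
      show s w (Ψ (a + b)) = s w (Ψ a) * s w (Ψ b)
      rw [hΨadd, f2cube_mul]
    have hsum : ∑ a, (fun a => if φ a = 0 then (1 : ℤ) else -1) a = 0 := by
      obtain ⟨a₁, ha₁⟩ := hφ
      have hs1 : (fun a => if φ a = 0 then (1 : ℤ) else -1) a₁ = -1 := by simp only; rw [if_neg ha₁]
      have h1 : ∑ a, (fun a => if φ a = 0 then (1 : ℤ) else -1) a =
          ∑ a, (fun a => if φ a = 0 then (1 : ℤ) else -1) (a + a₁) :=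
        (Fintype.sum_equiv (Equiv.addRight a₁) _ _ fun _ => rfl).symm
      simp only [hmul, hs1, ← Finset.sum_mul] at h1
      simp only at h1 ⊢
      linarith
    obtain ⟨-, -, hπ, -⟩ := parts_sgnSum_of_law_cube hρρ hρτ hτρ hττ hρ hτ hne hsurj h hS hT hU hV hmul hval hsum
    have hπ' : (∑ t ∈ T₀, s w (Ψ t)) = 1 ∨ (∑ t ∈ T₀, s w (Ψ t)) = -1 := hπ
    rcases hπ' with h1 | h1 <;> rw [h1] <;> norm_num
  -- the `w = 0` term is `|T₀|²`
  have h0 : (∑ t ∈ T₀, s 0 (Ψ t)) = T₀.card := by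
    simp only [s, Prod.fst_zero, Prod.snd_zero, zero_mul, add_zero, ↓reduceIte, sum_const, nsmul_eq_mul,
      mul_one]
  -- Parseval: `∑_w χ_w(T₀)² = 8 N`
  set N := ((T₀ ×ˢ T₀).filter fun p : A × A => Ψ p.1 + Ψ p.2 = 0).card with hN
  have hpars : (∑ w : ZMod 2 × ZMod 2 × ZMod 2, (∑ t ∈ T₀, s w (Ψ t)) ^ 2) = 8 * N := by
    have step : ∀ w : ZMod 2 × ZMod 2 × ZMod 2,
        (∑ t ∈ T₀, s w (Ψ t)) ^ 2 = ∑ p ∈ T₀ ×ˢ T₀, s w (Ψ p.1 + Ψ p.2) := by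
      intro w
      rw [sq, sum_mul_sum, ← sum_product']
      exact sum_congr rfl fun p _ => f2cube_mul w (Ψ p.1) (Ψ p.2)
    simp_rw [step]
    rw [sum_comm]
    have inner : ∀ p ∈ T₀ ×ˢ T₀, (∑ w : ZMod 2 × ZMod 2 × ZMod 2, s w (Ψ p.1 + Ψ p.2)) =
        if Ψ p.1 + Ψ p.2 = 0 then 8 else 0 := fun p _ => f2cube_orthogonality _
    rw [sum_congr rfl inner, ← sum_filter, sum_const, nsmul_eq_mul, mul_comm]
  -- split off `w = 0`: `|T₀|² + 7 = 8 N`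
  have hsplit : (∑ w : ZMod 2 × ZMod 2 × ZMod 2, (∑ t ∈ T₀, s w (Ψ t)) ^ 2) =
      (T₀.card : ℤ) ^ 2 + 7 := by
    rw [← Finset.sum_filter_add_sum_filter_not univ (fun w => w ≠ 0)]
    have hA7 : (∑ w ∈ univ.filter (fun w : ZMod 2 × ZMod 2 × ZMod 2 => w ≠ 0), (∑ t ∈ T₀, s w (Ψ t)) ^ 2) = 7 := by
      rw [sum_congr rfl fun w hw => hsq w (mem_filter.1 hw).2, sum_const, f2cube_card_ne_zero]
      norm_num
    have hB : (univ.filter fun w : ZMod 2 × ZMod 2 × ZMod 2 => ¬w ≠ 0) = {0} := by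
      ext w; simp
    rw [hA7, hB, sum_singleton, h0]
    ring
  -- fibrewise: `N = ∑_v n_v²`, `|T₀| = ∑_v n_v`, hence `N + |T₀|` is even
  have hVadd : ∀ a b : ZMod 2 × ZMod 2 × ZMod 2, a + b = 0 ↔ b = a := by decide
  have hNfib : N = ∑ v : ZMod 2 × ZMod 2 × ZMod 2, (T₀.filter fun t => Ψ t = v).card * (T₀.filter fun t => Ψ t = v).card := by
    rw [hN, card_eq_sum_card_fiberwise (f := fun p : A × A => Ψ p.1) (t := univ) (fun _ _ => mem_univ _)]
    refine sum_congr rfl fun v _ => ?_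
    rw [← card_product]
    congr 1
    ext p
    simp only [mem_filter, mem_product]
    constructor
    · rintro ⟨⟨⟨h1, h2⟩, h3⟩, h4⟩
      exact ⟨⟨h1, h4⟩, h2, by rw [← h4]; exact (hVadd _ _).1 h3⟩
    · rintro ⟨⟨h1, h4⟩, h2, h5⟩
      exact ⟨⟨⟨h1, h2⟩, (hVadd _ _).2 (by rw [h4, h5])⟩, h4⟩
  have hxfib : T₀.card = ∑ v : ZMod 2 × ZMod 2 × ZMod 2, (T₀.filter fun t => Ψ t = v).card :=
    card_eq_sum_card_fiberwise (f := Ψ) (t := univ) fun _ _ => mem_univ _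
  have heven : Even (N + T₀.card) := by
    rw [hNfib, hxfib, ← sum_add_distrib]
    refine even_sum _ fun v _ => ?_
    rw [← Nat.mul_succ]
    exact Nat.even_mul_succ_self _
  -- arithmetic: `x² + 7 = 8N`, `N ≡ x (mod 2)` ⇒ `x ≡ ±1 (mod 8)`
  have key : (T₀.card : ℤ) ^ 2 + 7 = 8 * N := by rw [← hsplit, hpars]
  have keyN : T₀.card ^ 2 + 7 = 8 * N := by exact_mod_cast key
  obtain ⟨m, hm⟩ := heven
  set x := T₀.card with hx
  set X := x ^ 2 with hX
  have hsq : X % 16 = (x % 16) ^ 2 % 16 := by rw [hX, Nat.pow_mod]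
  have hr16 : x % 16 < 16 := Nat.mod_lt _ (by norm_num)
  obtain ⟨r, hr, hxr⟩ : ∃ r, r < 16 ∧ x % 16 = r := ⟨_, hr16, rfl⟩
  rw [hxr] at hsq
  interval_cases r <;> norm_num at hsq <;> omega

/-- The same for the parts of `S` (rotation `(U, S, T)`). [folklore] -/
theorem cube_part_mod_eight_left
    (hρρ : ∀ a b, ρ a * ρ b = ρ (a + b)) (hρτ : ∀ a b, ρ a * τ b = τ (b - a))
    (hτρ : ∀ a b, τ a * ρ b = τ (a + b)) (hττ : ∀ a b, τ a * τ b = ρ (c₀ + b - a))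
    (hρ : Function.Injective ρ) (hτ : Function.Injective τ) (hne : ∀ a b, ρ a ≠ τ b)
    (hsurj : ∀ g, (∃ a, ρ a = g) ∨ (∃ a, τ a = g))
    (ψ₁ ψ₂ ψ₃ : A →+ ZMod 2) (hψ : ∀ v : ZMod 2 × ZMod 2 × ZMod 2, ∃ a, (ψ₁ a, ψ₂ a, ψ₃ a) = v)
    (h : TripleProductProperty S T U)
    (hS : (univ.filter fun a : A => ρ a ∈ S).card = (univ.filter fun a : A => τ a ∈ S).card)
    (hT : (univ.filter fun a : A => ρ a ∈ T).card = (univ.filter fun a : A => τ a ∈ T).card)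
    (hU : (univ.filter fun a : A => ρ a ∈ U).card = (univ.filter fun a : A => τ a ∈ U).card)
    (hV : 3 * (S.card * T.card * U.card) + 8 = 8 * Fintype.card A) :
    (univ.filter fun a : A => ρ a ∈ S).card % 8 = 1 ∨ (univ.filter fun a : A => ρ a ∈ S).card % 8 = 7 :=
  cube_part_mod_eight hρρ hρτ hτρ hττ hρ hτ hne hsurj ψ₁ ψ₂ ψ₃ hψ h.rotate.rotate hU hS hT
    (by rw [← hV]; ring)

/-- The same for the parts of `U` (rotation `(T, U, S)`). [folklore] -/
theorem cube_part_mod_eight_right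
    (hρρ : ∀ a b, ρ a * ρ b = ρ (a + b)) (hρτ : ∀ a b, ρ a * τ b = τ (b - a))
    (hτρ : ∀ a b, τ a * ρ b = τ (a + b)) (hττ : ∀ a b, τ a * τ b = ρ (c₀ + b - a))
    (hρ : Function.Injective ρ) (hτ : Function.Injective τ) (hne : ∀ a b, ρ a ≠ τ b)
    (hsurj : ∀ g, (∃ a, ρ a = g) ∨ (∃ a, τ a = g))
    (ψ₁ ψ₂ ψ₃ : A →+ ZMod 2) (hψ : ∀ v : ZMod 2 × ZMod 2 × ZMod 2, ∃ a, (ψ₁ a, ψ₂ a, ψ₃ a) = v)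
    (h : TripleProductProperty S T U)
    (hS : (univ.filter fun a : A => ρ a ∈ S).card = (univ.filter fun a : A => τ a ∈ S).card)
    (hT : (univ.filter fun a : A => ρ a ∈ T).card = (univ.filter fun a : A => τ a ∈ T).card)
    (hU : (univ.filter fun a : A => ρ a ∈ U).card = (univ.filter fun a : A => τ a ∈ U).card)
    (hV : 3 * (S.card * T.card * U.card) + 8 = 8 * Fintype.card A) :
    (univ.filter fun a : A => ρ a ∈ U).card % 8 = 1 ∨ (univ.filter fun a : A => ρ a ∈ U).card % 8 = 7 :=
  cube_part_mod_eight hρρ hρτ hτρ hττ hρ hτ hne hsurj ψ₁ ψ₂ ψ₃ hψ h.rotate hT hU hS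
    (by rw [← hV]; ring)

end DihedralLike

end Summit.MatrixMultiplication.OmegaCensus
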